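import Summits.CriticalPhenomena.PercolationContinuityZ3.Theorems.PercNearOneGluingNoHeavyQuantBlockCombRootGateRaise
import HarnessLib

/-!
# QUANT lane R8, FAR on trees: the HALF-CLASS theorem — FAR at every layer for every block-comb whose private gates are all at least
# `j/(A − j)` (canonical model; contains the class `(Σ a)·x > 2j` and the strong regime under the mean hypothesis)

builds on p205010 (kernel theorem, internal audit signed; external expert review pending)

Support file (`--supports stmt-CriticalPhenomena-4575`), QUANT lane seat prim-quant-p1 (gen 9); memo
`run/shared/lean/prim/quant/P1-SURPLUS.md` §20.  Theorems only (local notation, no definitions), no sorries, standard axioms.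
Model and notation: `…QuantBlockCombMergeModel.lean` (chain gates `q`, levels `lv`, sizes `a`, private gates `g`, explicit tail
`TAIL = P(N ≥ j+1)`, marginal of blob `k` = `(∏_{i<lv k} q i)·g k`, total size `A = Σ_k a k`); tools: the law-free merge step
`Quant.BlockComb.tail_transfer_le` (p1 g8, p242084), `sum_marg_le_contracted` (lead g13), and from this seat `tail_ge_of_raise_rootGate`,
`tail_succ_eq_rootSplit`, `tail_ge_of_rootStar`, `prefixProd_le_update_rootGate` (`…QuantBlockCombRootGateRaise.lean`), `sum_cast_transfer_mul`
(`…QuantBlockCombLightMerge.lean`).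

* **`Quant.BlockComb.tail_ge_of_halfClass` — THE HALF-CLASS THEOREM.**  Chain and private gates in `[0,1]`, live levels `≤ D`, `x` at
  most every live marginal, the MEAN hypothesis `2j < Σ_k a k·marginal k` (`= EN`), and every live blob `k` has `j ≤ g k·(A − j)` (private
  gate at least `j/(A − j)`; sure blobs qualify since `A ≥ EN > 2j`).  Then `x ≤ TAIL[D] = P(N ≥ j+1)`.
  PROOF (induction on `#live blobs + D`): a giant blob settles it (`tail_ge_marg_of_giant`); if every live blob is at the root,
  `tail_ge_of_rootStar` (FAR for independent blobs); otherwise `q 0 > 0` and, with `ρ` the least live ROOT gate: if `x ≤ q 0·ρ` raise the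
  first gate to `1` (`tail_ge_of_raise_rootGate`) — the instance with a sure first gate is the contracted one (`tail_succ_eq_rootSplit`), one
  level fewer, target `x/q 0 ≤ ρ`, mean not smaller (`sum_marg_le_contracted`); else raise it to `t = q 0·ρ/x < 1`, after which the least
  reliable root blob `τ` is TIED at the new target `ρ`, every marginal is `≥ ρ`, the mean has not decreased, and `τ` satisfies the merge
  hypothesis `j ≤ ρ·(A − a τ)` (`a τ ≤ j` as no blob is a giant, `ρ·(A − j) ≥ j`), so `tail_transfer_le` moves it into some live blob `ℓ`
  of marginal `≥ ρ` — the mean does not decrease, `A` and all gates are unchanged — one live blob fewer.  Exact weights throughout; no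
  window functional; no interior minimum is located.
  CONTAINS (under `EN > 2j`, the standing hypothesis of the row): the class theorem `tail_ge_of_class` (`A·x > 2j` gives every live gate
  `≥ x > 2j/A ≥ j/(A − j)`), hence the strong regime and every all-tied block-comb; and most of the root-heavy two-plateau residual left by
  `…QuantBlockCombLightRoots.lean` (root mass `> j`, light root gates in `[j/(A−j), q D)`).  Since `A > 2j`, the threshold `j/(A − j) < 1`
  and tends to `0` as `A → ∞`: **many relays ⟹ FAR**, whatever the gates.
* `Quant.BlockComb.tail_ge_prod_of_halfClass` — the form with `x = ∏_{i<D} q i` (the terminal marginal).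
Honest scope: a live blob with private gate `< j/(A − j)` (few relays in total AND a genuinely unreliable blob: LEAD-NOTES-G13 N24 (4)'s
harmonic staircase has a tied root gate `0.01` against a threshold `≈ 3/29`) is NOT covered; there the merge of the tied root blob is
unavailable and the row needs an anti-concentration input (memo §20).  Coverage census (exact, memo §20.5): in the budget-binding band
`EN ∈ (2j, 2.3j]` of random block-combs the kernel criteria before this generation settle 66 %, with the light-merge row 88 %, with this
theorem 92 % (and 99 % together with the one-plateau `far_indepBlob` bound); the remaining instances have `tail/x ≥ 1.7`.
-/

namespace Summit.CriticalPhenomena.PercolationContinuityZ3.Theorems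

namespace Quant

namespace BlockComb

open Finset

variable {κ : Type*} [Fintype κ] [DecidableEq κ]

/-- product-Bernoulli weight of the set `S` of open blob gates -/
local notation3 "wt[" g ", " S "]" => ∏ k, (if k ∈ (S : Finset κ) then (g : κ → ℝ) k else 1 - (g : κ → ℝ) k)

/-- the same weight with the gate of `s` removed -/
local notation3 "wt'[" g ", " s ", " S "]" =>
  ∏ k ∈ (Finset.univ : Finset κ).erase s, (if k ∈ (S : Finset κ) then (g : κ → ℝ) k else 1 - (g : κ → ℝ) k)

/-- probability that the chain `q` of length `D` is open exactly to depth `i` -/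
local notation3 "pd[" D ", " q ", " i "]" =>
  (∏ i' ∈ Finset.range (i : ℕ), (q : ℕ → ℝ) i') * (if (i : ℕ) < (D : ℕ) then 1 - (q : ℕ → ℝ) i else 1)

/-- mass counted at depth `i` in blob configuration `S` -/
local notation3 "mass[" lv ", " a ", " i ", " S "]" =>
  ∑ k ∈ (S : Finset κ).filter (fun k => (lv : κ → ℕ) k ≤ (i : ℕ)), ((a : κ → ℕ) k : ℕ)

/-- the tail `P(N ≥ j+1)` of the block-comb count, as an explicit finite sum -/
local notation3 "TAIL[" D ", " q ", " lv ", " a ", " g ", " j "]" =>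
  ∑ i ∈ Finset.range ((D : ℕ) + 1), pd[D, q, i] *
    ∑ S : Finset κ, wt[g, S] * (if (j : ℕ) + 1 ≤ mass[lv, a, i, S] then (1 : ℝ) else 0)

/-! ### 3. The half-class theorem -/

/-- The induction behind `tail_ge_of_halfClass` (on `#live blobs + D`): giant / every live blob at the root / raise the first gate to
`1` and contract / raise the first gate until the least reliable root blob is tied and merge it. [this work] -/
theorem tail_ge_of_halfClass_aux : ∀ (N : ℕ) (D : ℕ) (q : ℕ → ℝ), (∀ i, 0 ≤ q i ∧ q i ≤ 1) →
    ∀ (lv : κ → ℕ) (a : κ → ℕ) (g : κ → ℝ), (∀ k, 0 ≤ g k ∧ g k ≤ 1) → ∀ (j : ℕ) (x : ℝ),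
    (∀ k, 0 < a k → lv k ≤ D) →
    (∀ k, 0 < a k → x ≤ (∏ i ∈ Finset.range (lv k), q i) * g k) →
    (2 * j : ℝ) < ∑ k, (a k : ℝ) * ((∏ i ∈ Finset.range (lv k), q i) * g k) →
    (∀ k, 0 < a k → (j : ℝ) ≤ g k * ((∑ k', (a k' : ℝ)) - j)) →
    (Finset.univ.filter (fun k => 0 < a k)).card + D ≤ N →
    x ≤ TAIL[D, q, lv, a, g, j] := by
  intro N
  induction N with
  | zero =>
    intro D q hq lv a g hg j x hlv hx hmean hhalf hN
    -- no live blob: the mean is `0`, contradiction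
    have hnone : ∀ k, a k = 0 := by
      intro k
      by_contra hne
      have hmem : k ∈ Finset.univ.filter (fun k => 0 < a k) := Finset.mem_filter.2 ⟨Finset.mem_univ _, Nat.pos_of_ne_zero hne⟩
      have := Finset.card_pos.2 ⟨k, hmem⟩
      omega
    have h0 : ∑ k, (a k : ℝ) * ((∏ i ∈ Finset.range (lv k), q i) * g k) = 0 :=
      Finset.sum_eq_zero fun k _ => by rw [hnone k]; simp
    rw [h0] at hmean
    have : (0 : ℝ) ≤ 2 * j := by positivity
    linarith
  | succ N ih =>
    intro D q hq lv a g hg j x hlv hx hmean hhalf hN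
    -- (0) trivial target
    rcases le_or_gt x 0 with hx0 | hx0
    · exact hx0.trans (tail_nonneg D q hq lv a g hg j)
    -- (i) a giant blob
    by_cases hgiant : ∃ k, 0 < a k ∧ j + 1 ≤ a k
    · obtain ⟨k, hk, hkj⟩ := hgiant
      exact (hx k hk).trans (tail_ge_marg_of_giant D q hq lv a g hg j k hkj (hlv k hk))
    push Not at hgiant
    -- total size and the mean bound `2j < A`
    set A : ℝ := ∑ k', (a k' : ℝ) with hA
    have hmargle : ∀ k, (∏ i ∈ Finset.range (lv k), q i) * g k ≤ 1 := fun k =>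
      mul_le_one₀ (prefixProd_mem q hq (lv k)).2 (hg k).1 (hg k).2
    have hENleA : ∑ k, (a k : ℝ) * ((∏ i ∈ Finset.range (lv k), q i) * g k) ≤ A :=
      Finset.sum_le_sum fun k _ => by
        have := mul_le_mul_of_nonneg_left (hmargle k) (Nat.cast_nonneg (a k))
        rwa [mul_one] at this
    have h2jA : (2 * j : ℝ) < A := hmean.trans_le hENleA
    -- (ii) every live blob at the root: the block-star row
    by_cases hallroot : ∀ k, 0 < a k → lv k = 0
    · refine tail_ge_of_rootStar D q hq lv a g hg j x hallroot (fun k hk => ?_) ?_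
      · have h := hx k hk
        rw [hallroot k hk, Finset.prod_range_zero, one_mul] at h
        exact h
      · refine hmean.trans_le (le_of_eq (Finset.sum_congr rfl fun k _ => ?_))
        by_cases hk : 0 < a k
        · rw [hallroot k hk, Finset.prod_range_zero, one_mul]
        · have : a k = 0 := by omega
          rw [this]; simp
    push Not at hallroot
    obtain ⟨k₁, hk₁, hk₁lv⟩ := hallroot
    -- hence `D ≥ 1` and `q 0 > 0`
    obtain ⟨D', rfl⟩ : ∃ D', D = D' + 1 := ⟨D - 1, by have := hlv k₁ hk₁; omega⟩
    have hq0 : 0 < q 0 := by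
      rcases (hq 0).1.lt_or_eq with h | h
      · exact h
      · exfalso
        have hm := hx k₁ hk₁
        obtain ⟨n, hn⟩ := Nat.exists_eq_succ_of_ne_zero hk₁lv
        rw [hn, prefixProd_succ, ← h, zero_mul, zero_mul] at hm
        exact absurd hm (not_le.2 hx0)
    -- the contracted instance and its hypotheses (used in both remaining cases, for any first gate `t ≥ q 0`)
    have hq' : ∀ i, 0 ≤ q (i + 1) ∧ q (i + 1) ≤ 1 := fun i => hq (i + 1)
    have hlv' : ∀ k, 0 < a k → lv k - 1 ≤ D' := fun k hk => by have := hlv k hk; omega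
    -- live root blobs and their least gate
    by_cases hcontract : ∀ k, 0 < a k → lv k = 0 → x ≤ q 0 * g k
    · -- (iii) raise the first gate to `1` and contract one level
      refine tail_ge_of_raise_rootGate D' q lv a g hg j 1 hq0 (hq 0).2 x ?_
      rw [tail_succ_eq_rootSplit, Function.update_self, sub_self, zero_mul, zero_add, one_mul]
      have hsucc : (fun i => Function.update q 0 1 (i + 1)) = (fun i => q (i + 1)) := by
        funext i; exact Function.update_of_ne (Nat.succ_ne_zero i) 1 q
      rw [hsucc, mul_one]
      refine ih D' (fun i => q (i + 1)) hq' (fun k => lv k - 1) a g hg j (x / q 0) hlv' ?_ ?_ hhalf (by omega)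
      · -- marginals of the contracted instance are `≥ x / q 0`
        intro k hk
        rw [div_le_iff₀ hq0]
        by_cases hk0 : lv k = 0
        · rw [hk0]; simpa [mul_comm] using hcontract k hk hk0
        · obtain ⟨n, hn⟩ := Nat.exists_eq_succ_of_ne_zero hk0
          have h := hx k hk
          rw [hn, prefixProd_succ] at h
          rw [hn, Nat.succ_sub_one]
          linarith [h]
      · exact hmean.trans_le (sum_marg_le_contracted q hq lv a g hg)
    · -- (iv) tie the least reliable root blob and merge it
      push Not at hcontract
      have hRne : (Finset.univ.filter (fun k => 0 < a k ∧ lv k = 0)).Nonempty := by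
        obtain ⟨k, hk, hk0, _⟩ := hcontract
        exact ⟨k, Finset.mem_filter.2 ⟨Finset.mem_univ _, hk, hk0⟩⟩
      obtain ⟨τ, hτmem, hτmin⟩ := Finset.exists_min_image (Finset.univ.filter (fun k => 0 < a k ∧ lv k = 0)) g hRne
      have hτ : 0 < a τ := (Finset.mem_filter.1 hτmem).2.1
      have hτ0 : lv τ = 0 := (Finset.mem_filter.1 hτmem).2.2
      set ρ : ℝ := g τ with hρ
      have hρx : x ≤ ρ := by
        have h := hx τ hτ
        rw [hτ0, Finset.prod_range_zero, one_mul] at h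
        exact h
      have hρlt : q 0 * ρ < x := by
        obtain ⟨k, hk, hk0, hlt⟩ := hcontract
        have hmin := hτmin k (Finset.mem_filter.2 ⟨Finset.mem_univ _, hk, hk0⟩)
        nlinarith [(hq 0).1]
      have hρ0 : 0 < ρ := hx0.trans_le hρx
      -- the new first gate `t = q 0·ρ/x ∈ [q 0, 1)`
      set t : ℝ := q 0 * ρ / x with ht
      have hqt : q 0 ≤ t := by
        rw [ht, le_div_iff₀ hx0]; exact mul_le_mul_of_nonneg_left hρx (hq 0).1
      have ht1 : t ≤ 1 := by rw [ht, div_le_one hx0]; exact hρlt.le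
      have ht0 : 0 ≤ t := (hq 0).1.trans hqt
      have hxt : x * t / q 0 = ρ := by rw [ht]; field_simp
      refine tail_ge_of_raise_rootGate D' q lv a g hg j t hq0 hqt x ?_
      rw [hxt]
      set q' : ℕ → ℝ := Function.update q 0 t with hq'def
      have hq'01 : ∀ i, 0 ≤ q' i ∧ q' i ≤ 1 := by
        intro i
        by_cases hi : i = 0
        · rw [hi, hq'def, Function.update_self]; exact ⟨ht0, ht1⟩
        · rw [hq'def, Function.update_of_ne hi]; exact hq i
      -- marginals under the raised gate: root blobs unchanged, deeper blobs scaled by `t / q 0`, all `≥ ρ`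
      have hmarg' : ∀ k, 0 < a k → ρ ≤ (∏ i ∈ Finset.range (lv k), q' i) * g k := by
        intro k hk
        by_cases hk0 : lv k = 0
        · rw [hk0, Finset.prod_range_zero, one_mul]
          exact hτmin k (Finset.mem_filter.2 ⟨Finset.mem_univ _, hk, hk0⟩)
        · obtain ⟨n, hn⟩ := Nat.exists_eq_succ_of_ne_zero hk0
          have h := hx k hk
          rw [hn, prefixProd_succ] at h
          rw [hn, hq'def, prefixProd_update_succ]
          -- `t·P·g = (ρ/x)·(q 0·P·g) ≥ (ρ/x)·x = ρ`
          have h1 : t * (∏ i ∈ Finset.range n, q (i + 1)) * g k =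
              (ρ / x) * (q 0 * (∏ i ∈ Finset.range n, q (i + 1)) * g k) := by
            rw [ht]; ring
          rw [h1]
          have h2 : x ≤ q 0 * (∏ i ∈ Finset.range n, q (i + 1)) * g k := by linarith [h]
          calc ρ = (ρ / x) * x := by field_simp
            _ ≤ (ρ / x) * (q 0 * (∏ i ∈ Finset.range n, q (i + 1)) * g k) :=
                mul_le_mul_of_nonneg_left h2 (div_nonneg hρ0.le hx0.le)
      have hmargmono : ∀ k, (∏ i ∈ Finset.range (lv k), q i) * g k ≤ (∏ i ∈ Finset.range (lv k), q' i) * g k :=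
        fun k => mul_le_mul_of_nonneg_right (prefixProd_le_update_rootGate q hq t hqt (lv k)) (hg k).1
      have hmeanq' : (2 * j : ℝ) < ∑ k, (a k : ℝ) * ((∏ i ∈ Finset.range (lv k), q' i) * g k) :=
        hmean.trans_le (Finset.sum_le_sum fun k _ => mul_le_mul_of_nonneg_left (hmargmono k) (Nat.cast_nonneg _))
      -- the merge step for the tied root blob `τ`
      have hτj : a τ ≤ j := Nat.lt_succ_iff.1 (hgiant τ hτ)
      set a₀ := Function.update a τ 0 with ha₀
      have ha₀τ : a₀ τ = 0 := by rw [ha₀, Function.update_self]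
      have ha₀ne : ∀ k, k ≠ τ → a₀ k = a k := fun k hk => by rw [ha₀, Function.update_of_ne hk]
      have hsum₀ : ∑ k, ((a₀ k : ℕ) : ℝ) = A - a τ := by
        rw [hA, Finset.sum_eq_add_sum_sdiff_singleton_of_mem (Finset.mem_univ τ) (fun k => (a k : ℝ)),
          Finset.sum_eq_add_sum_sdiff_singleton_of_mem (Finset.mem_univ τ) (fun k => ((a₀ k : ℕ) : ℝ)), ha₀τ]
        push_cast
        have : ∑ x ∈ Finset.univ \ {τ}, ((a₀ x : ℕ) : ℝ) = ∑ x ∈ Finset.univ \ {τ}, (a x : ℝ) :=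
          Finset.sum_congr rfl fun k hk => by
            have hks : k ≠ τ := fun h => by
              rw [Finset.mem_sdiff, Finset.mem_singleton] at hk; exact hk.2 h
            rw [ha₀ne k hks]
        rw [this]; ring
      have hM : (j : ℝ) ≤ g τ * ∑ k, ((a₀ k : ℕ) : ℝ) := by
        rw [hsum₀]
        have h1 := hhalf τ hτ
        have h2 : (a τ : ℝ) ≤ j := by exact_mod_cast hτj
        nlinarith [(hg τ).1]
      have hpos : ∃ k, 0 < a₀ k := by
        by_contra hnone
        push Not at hnone
        have hzero : ∑ k, ((a₀ k : ℕ) : ℝ) = 0 :=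
          Finset.sum_eq_zero fun k _ => by rw [Nat.le_zero.1 (hnone k)]; simp
        rw [hsum₀] at hzero
        have h2 : (a τ : ℝ) ≤ j := by exact_mod_cast hτj
        have h3 : (0 : ℝ) ≤ j := Nat.cast_nonneg j
        linarith
      obtain ⟨ℓ, hℓ, hle⟩ := tail_transfer_le (D' + 1) q' hq'01 lv a g hg j τ hτ0 hM hpos
      have hℓτ : ℓ ≠ τ := by
        intro h; rw [h, Function.update_self] at hℓ; exact lt_irrefl _ hℓ
      have haℓ : 0 < a ℓ := by rw [← ha₀ne ℓ hℓτ]; exact hℓ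
      set aT := Function.update a₀ ℓ (a₀ ℓ + a τ) with haT
      have haTτ : aT τ = 0 := by rw [haT, Function.update_of_ne hℓτ.symm, ha₀τ]
      have haTℓ : aT ℓ = a ℓ + a τ := by rw [haT, Function.update_self, ha₀ne ℓ hℓτ]
      have haTne : ∀ k, k ≠ τ → k ≠ ℓ → aT k = a k := fun k hks hkℓ => by
        rw [haT, Function.update_of_ne hkℓ, ha₀ne k hks]
      have hlive : ∀ k, 0 < aT k → 0 < a k ∧ k ≠ τ := by
        intro k hk
        have hks : k ≠ τ := fun h => by rw [h, haTτ] at hk; exact lt_irrefl _ hk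
        refine ⟨?_, hks⟩
        by_cases hkℓ : k = ℓ
        · rw [hkℓ]; exact haℓ
        · rw [← haTne k hks hkℓ]; exact hk
      have hcard : (Finset.univ.filter (fun k => 0 < aT k)).card + 1 ≤ (Finset.univ.filter (fun k => 0 < a k)).card := by
        have hsub : Finset.univ.filter (fun k => 0 < aT k) ⊆ (Finset.univ.filter (fun k => 0 < a k)).erase τ := by
          intro k hk
          have hk' := (Finset.mem_filter.1 hk).2
          exact Finset.mem_erase.2 ⟨(hlive k hk').2, Finset.mem_filter.2 ⟨Finset.mem_univ _, (hlive k hk').1⟩⟩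
        have hsmem : τ ∈ Finset.univ.filter (fun k => 0 < a k) := Finset.mem_filter.2 ⟨Finset.mem_univ _, hτ⟩
        have h1 := Finset.card_le_card hsub
        rw [Finset.card_erase_of_mem hsmem] at h1
        have hpos' : 0 < (Finset.univ.filter (fun k => 0 < a k)).card := Finset.card_pos.2 ⟨τ, hsmem⟩
        omega
      -- total size unchanged, mean not decreased
      have hsumT : ∑ k', ((aT k' : ℕ) : ℝ) = A := by
        have h := sum_cast_transfer_mul a τ ℓ hℓτ (fun _ => (1 : ℝ))
        simp only [mul_one, sub_self, mul_zero, add_zero] at h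
        rw [haT, ha₀, h]
      have hmeanT : (2 * j : ℝ) < ∑ k, (aT k : ℝ) * ((∏ i ∈ Finset.range (lv k), q' i) * g k) := by
        rw [haT, ha₀, sum_cast_transfer_mul a τ ℓ hℓτ]
        have hgain : 0 ≤ (a τ : ℝ) * ((∏ i ∈ Finset.range (lv ℓ), q' i) * g ℓ - (∏ i ∈ Finset.range (lv τ), q' i) * g τ) := by
          refine mul_nonneg (Nat.cast_nonneg _) (sub_nonneg.2 ?_)
          rw [hτ0, Finset.prod_range_zero, one_mul]
          exact hmarg' ℓ haℓ
        linarith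
      have hih := ih (D' + 1) q' hq'01 lv aT g hg j ρ (fun k hk => hlv k (hlive k hk).1)
        (fun k hk => hmarg' k (hlive k hk).1) hmeanT
        (fun k hk => by rw [hsumT]; exact hhalf k (hlive k hk).1) (by omega)
      exact hih.trans hle

/-- **THEOREM (the half-class theorem: FAR at every layer for every block-comb whose private gates are at least `j/(A − j)`, canonical
model).**  Chain gates and private gates in `[0,1]`, live levels `≤ D`, `x` at most every live marginal `(∏_{i<lv k} q i)·g k`, the mean
hypothesis `2j < Σ_k a k·marginal k`, and `j ≤ g k·(A − j)` for every live blob (`A = Σ_k a k`).  Then `x ≤ TAIL[D, q, lv, a, g, j] =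
P(N ≥ j+1)`.  Contains `tail_ge_of_class` under the mean hypothesis; covers the root-heavy light-root block-combs. [this work] -/
theorem tail_ge_of_halfClass (D : ℕ) (q : ℕ → ℝ) (hq : ∀ i, 0 ≤ q i ∧ q i ≤ 1) (lv : κ → ℕ) (a : κ → ℕ)
    (g : κ → ℝ) (hg : ∀ k, 0 ≤ g k ∧ g k ≤ 1) (j : ℕ) (hlv : ∀ k, 0 < a k → lv k ≤ D) (x : ℝ)
    (hx : ∀ k, 0 < a k → x ≤ (∏ i ∈ Finset.range (lv k), q i) * g k)
    (hmean : (2 * j : ℝ) < ∑ k, (a k : ℝ) * ((∏ i ∈ Finset.range (lv k), q i) * g k))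
    (hhalf : ∀ k, 0 < a k → (j : ℝ) ≤ g k * ((∑ k', (a k' : ℝ)) - j)) :
    x ≤ TAIL[D, q, lv, a, g, j] :=
  tail_ge_of_halfClass_aux _ D q hq lv a g hg j x hlv hx hmean hhalf le_rfl

/-- **COROLLARY (the half-class theorem with `x` = the terminal marginal).**  Chain of `D` gates, live levels `≤ D`, every live marginal
`≥ ∏_{i<D} q i =: x` (the standing hypothesis of the block-comb row: the terminal block is the least likely relay class), `EN > 2j`, and every
live private gate `≥ j/(A − j)`; then `x ≤ P(N ≥ j+1)`. [this work] -/
theorem tail_ge_prod_of_halfClass (D : ℕ) (q : ℕ → ℝ) (hq : ∀ i, 0 ≤ q i ∧ q i ≤ 1) (lv : κ → ℕ) (a : κ → ℕ)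
    (g : κ → ℝ) (hg : ∀ k, 0 ≤ g k ∧ g k ≤ 1) (j : ℕ) (hlv : ∀ k, 0 < a k → lv k ≤ D)
    (hx : ∀ k, 0 < a k → ∏ i ∈ Finset.range D, q i ≤ (∏ i ∈ Finset.range (lv k), q i) * g k)
    (hmean : (2 * j : ℝ) < ∑ k, (a k : ℝ) * ((∏ i ∈ Finset.range (lv k), q i) * g k))
    (hhalf : ∀ k, 0 < a k → (j : ℝ) ≤ g k * ((∑ k', (a k' : ℝ)) - j)) :
    ∏ i ∈ Finset.range D, q i ≤ TAIL[D, q, lv, a, g, j] :=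
  tail_ge_of_halfClass D q hq lv a g hg j hlv _ hx hmean hhalf

end BlockComb

end Quant

end Summit.CriticalPhenomena.PercolationContinuityZ3.Theorems
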